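import Mathlib
import Summits.MatrixMultiplication.MatrixMultiplication.Theorems.SnSubsetDichotomyPolynomialSlackPolylogPower

/-!
# `SnSubsetDichotomy.PolynomialSlack`, line `transport-split-hull` — stub `eventually_sharp_ranges`

The elementary "`n` large enough" range facts of the level-one (`5/8`-step) programme behind the
polynomial-slack thesis (crux `stmt-MatrixMultiplication-8306`, registered stub
`eventually_sharp_ranges` of `Cruxes/PolynomialSlack/Lines/transport-split-hull.lean`).
For a triple-product-property triple of `S_n` with parameter `F ∈ (0, 8 n^{C₁}]` (`C₁ < 3/4`)
the final induction works at the scale `M := P · F² / (n - 1)` with `P := 10^34 · (1 + log n)^18`;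
the sharp structure theorem needs, uniformly in such `F` and for all large `n`:
`40 ≤ n`, `1400000 (1 + log n)² ≤ n`, `M ≤ n⁴`, `4096 M³ ≤ F²` and
`F √6 / √(n (n - 1)) ≤ 1/2`.  This file is pure real analysis.

Proof.  Write `x = n ≥ 2`, `G = 1 + log x` and `Q = x^{C₁}`, so `0 < F ≤ 8 Q`, `F² ≤ 64 Q²`,
`F⁴ ≤ 4096 Q⁴`, and `x - 1 ≥ x / 2`, `√(x (x - 1)) ≥ x - 1`, `√6 ≤ 3`.
* `1400000 G² ≤ x` is the master comparison `eventually_log_pow_mul_rpow_le` with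
  `(k, p, q) = (2, 0, 1)`.
* `M ≤ x⁴`: `P F² ≤ 64 P Q²`, and `128 · 10^34 · G^18 · x^{2 C₁} ≤ x⁵` (master comparison,
  `2 C₁ < 5`) gives `64 P Q² ≤ x⁵ / 2 ≤ x⁴ (x - 1)`.
* `4096 M³ ≤ F²`, i.e. `4096 P³ F⁶ ≤ F² (x - 1)³`: `F⁶ = F⁴ F² ≤ 4096 Q⁴ F²` and
  `8 · 4096² · 10^102 · G^54 · x^{4 C₁} ≤ x³` (master comparison, `4 C₁ < 3`) together with
  `x³ ≤ 8 (x - 1)³`.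
* `F √6 / √(x (x - 1)) ≤ 1/2`: `2 F √6 ≤ 48 Q ≤ x / 2 ≤ x - 1 ≤ √(x (x - 1))` once `96 x^{C₁} ≤ x`
  (master comparison, `C₁ < 1`).
The threshold `n₀` is the maximum of `40` and the four thresholds.
-/

namespace Summit.MatrixMultiplication.MatrixMultiplication.Theorems.PolynomialSlack

-- `Summit.<Summit>.<Problem>` is the tree's mandated summit-side namespace; for this
-- single-conjunct summit the two coincide, so the file silences `dupNamespace`.
set_option linter.dupNamespace false

open scoped BigOperators

/-- Second range fact: if `0 ≤ F ≤ 8 Q` and `128 · 10^34 · G^18 · Q² ≤ x⁵` with `x ≥ 2`, then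
`10^34 G^18 F² / (x - 1) ≤ x⁴` (`F² ≤ 64 Q²`, `x⁵ / 2 ≤ x⁴ (x - 1)`). [folklore] -/
theorem sharpRanges_scale_le {x F Q G : ℝ} (hx : 2 ≤ x) (hF0 : 0 ≤ F) (hFle : F ≤ 8 * Q)
    (h : 128 * 10 ^ 34 * G ^ 18 * (Q * Q) ≤ x ^ 5) :
    10 ^ 34 * G ^ 18 * F ^ 2 / (x - 1) ≤ x ^ 4 := by
  have hx1 : 0 < x - 1 := by linarith
  have hF2 : F ^ 2 ≤ 64 * (Q * Q) :=
    calc F ^ 2 ≤ (8 * Q) ^ 2 := pow_le_pow_left₀ hF0 hFle 2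
      _ = 64 * (Q * Q) := by ring
  have hG : 0 ≤ 10 ^ 34 * G ^ 18 := by positivity
  have h4 : x ^ 4 * 2 ≤ x ^ 4 * x := mul_le_mul_of_nonneg_left hx (by positivity)
  rw [div_le_iff₀ hx1]
  calc 10 ^ 34 * G ^ 18 * F ^ 2 ≤ 10 ^ 34 * G ^ 18 * (64 * (Q * Q)) :=
        mul_le_mul_of_nonneg_left hF2 hG
    _ = 128 * 10 ^ 34 * G ^ 18 * (Q * Q) / 2 := by ring
    _ ≤ x ^ 5 / 2 := by linarith
    _ ≤ x ^ 4 * (x - 1) := by nlinarith [h4]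

/-- Third range fact: if `0 ≤ F ≤ 8 Q` and `8 · 4096² · 10^102 · G^54 · Q⁴ ≤ x³` with `x ≥ 2`, then
`4096 (10^34 G^18 F² / (x - 1))³ ≤ F²` (`F⁴ ≤ 4096 Q⁴`, `x³ ≤ 8 (x - 1)³`). [folklore] -/
theorem sharpRanges_cube_le {x F Q G : ℝ} (hx : 2 ≤ x) (hF0 : 0 ≤ F) (hFle : F ≤ 8 * Q)
    (h : 8 * 4096 ^ 2 * 10 ^ 102 * G ^ 54 * (Q * Q * Q * Q) ≤ x ^ 3) :
    4096 * (10 ^ 34 * G ^ 18 * F ^ 2 / (x - 1)) ^ 3 ≤ F ^ 2 := by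
  have hx1 : 0 < x - 1 := by linarith
  have hF4 : F ^ 4 ≤ 4096 * (Q * Q * Q * Q) :=
    calc F ^ 4 ≤ (8 * Q) ^ 4 := pow_le_pow_left₀ hF0 hFle 4
      _ = 4096 * (Q * Q * Q * Q) := by ring
  have hx3 : x ^ 3 ≤ 8 * (x - 1) ^ 3 :=
    calc x ^ 3 ≤ (2 * (x - 1)) ^ 3 := pow_le_pow_left₀ (by linarith) (by linarith) 3
      _ = 8 * (x - 1) ^ 3 := by ring
  have hG : 0 ≤ 4096 * 10 ^ 102 * G ^ 54 := by positivity
  rw [div_pow, mul_div_assoc', div_le_iff₀ (by positivity)]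
  calc 4096 * (10 ^ 34 * G ^ 18 * F ^ 2) ^ 3
      = 4096 * 10 ^ 102 * G ^ 54 * F ^ 4 * F ^ 2 := by ring
    _ ≤ 4096 * 10 ^ 102 * G ^ 54 * (4096 * (Q * Q * Q * Q)) * F ^ 2 :=
        mul_le_mul_of_nonneg_right (mul_le_mul_of_nonneg_left hF4 hG) (sq_nonneg F)
    _ = 8 * 4096 ^ 2 * 10 ^ 102 * G ^ 54 * (Q * Q * Q * Q) * F ^ 2 / 8 := by ring
    _ ≤ x ^ 3 * F ^ 2 / 8 := by gcongr
    _ ≤ 8 * (x - 1) ^ 3 * F ^ 2 / 8 := by gcongr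
    _ = F ^ 2 * (x - 1) ^ 3 := by ring

/-- Fourth range fact: if `0 ≤ F ≤ 8 Q` and `96 Q ≤ x` with `x ≥ 2`, then
`F √6 / √(x (x - 1)) ≤ 1/2` (`√6 ≤ 3`, `√(x (x - 1)) ≥ x - 1 ≥ x / 2`). [folklore] -/
theorem sharpRanges_err_le {x F Q : ℝ} (hx : 2 ≤ x) (hF0 : 0 ≤ F) (hFle : F ≤ 8 * Q)
    (h : 96 * Q ≤ x) :
    F * (Real.sqrt 6 / Real.sqrt (x * (x - 1))) ≤ 1 / 2 := by
  have hx0 : 0 < x := by linarith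
  have hx1 : 0 < x - 1 := by linarith
  have hQ : 0 ≤ Q := by linarith
  have h6 : Real.sqrt 6 ≤ 3 := by
    calc Real.sqrt 6 ≤ Real.sqrt (3 ^ 2) := Real.sqrt_le_sqrt (by norm_num)
      _ = 3 := Real.sqrt_sq (by norm_num)
  have hden : x - 1 ≤ Real.sqrt (x * (x - 1)) := by
    calc x - 1 = Real.sqrt ((x - 1) ^ 2) := (Real.sqrt_sq hx1.le).symm
      _ ≤ Real.sqrt (x * (x - 1)) := Real.sqrt_le_sqrt (by nlinarith)
  have hpos : 0 < Real.sqrt (x * (x - 1)) := Real.sqrt_pos.2 (mul_pos hx0 hx1)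
  rw [mul_div_assoc', div_le_div_iff₀ hpos (by norm_num)]
  calc F * Real.sqrt 6 * 2 ≤ 8 * Q * 3 * 2 := by gcongr
    _ = 96 * Q / 2 := by ring
    _ ≤ x / 2 := by gcongr
    _ ≤ 1 * Real.sqrt (x * (x - 1)) := by linarith

/-- Real-variable assembly: from the four instances of the master polylog-versus-power
comparison (in the raw `Real.rpow` form in which `eventually_log_pow_mul_rpow_le` delivers them)
at a real `x ≥ 2` and any `F` with `0 < F ≤ 8 x^{C₁}`, the four real range facts follow.
[folklore] -/
theorem sharpRanges_of_master {x C₁ F : ℝ} (hx : 2 ≤ x) (hF0 : 0 < F) (hFle : F ≤ 8 * x ^ C₁)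
    (h₂ : 1400000 * (1 + Real.log x) ^ 2 * x ^ (0 : ℝ) ≤ x ^ (1 : ℝ))
    (h₃ : 128 * 10 ^ 34 * (1 + Real.log x) ^ 18 * x ^ (C₁ + C₁) ≤ x ^ ((5 : ℕ) : ℝ))
    (h₄ : 8 * 4096 ^ 2 * 10 ^ 102 * (1 + Real.log x) ^ 54 * x ^ (C₁ + C₁ + C₁ + C₁) ≤
      x ^ ((3 : ℕ) : ℝ))
    (h₅ : 96 * (1 + Real.log x) ^ 0 * x ^ C₁ ≤ x ^ (1 : ℝ)) :
    1400000 * (1 + Real.log x) ^ 2 ≤ x ∧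
      10 ^ 34 * (1 + Real.log x) ^ 18 * F ^ 2 / (x - 1) ≤ x ^ 4 ∧
      4096 * (10 ^ 34 * (1 + Real.log x) ^ 18 * F ^ 2 / (x - 1)) ^ 3 ≤ F ^ 2 ∧
      F * (Real.sqrt 6 / Real.sqrt (x * (x - 1))) ≤ 1 / 2 := by
  have hx0 : 0 < x := lt_of_lt_of_le two_pos hx
  rw [Real.rpow_zero, mul_one, Real.rpow_one] at h₂
  rw [Real.rpow_add hx0, Real.rpow_natCast] at h₃
  rw [Real.rpow_add hx0, Real.rpow_add hx0, Real.rpow_add hx0, Real.rpow_natCast] at h₄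
  rw [pow_zero, mul_one, Real.rpow_one] at h₅
  exact ⟨h₂, sharpRanges_scale_le hx hF0.le hFle h₃, sharpRanges_cube_le hx hF0.le hFle h₄,
    sharpRanges_err_le hx hF0.le hFle h₅⟩

/-- **The sharp range facts hold eventually** (registered stub `eventually_sharp_ranges` of line
`transport-split-hull`): for `C₁ < 3/4` there is `n₀` such that for all `n ≥ n₀` and all `F` with
`0 < F ≤ 8 n^{C₁}` one has `40 ≤ n`, `1400000 (1 + log n)² ≤ n`,
`10^34 (1 + log n)^18 F² / (n - 1) ≤ n⁴`, `4096 (10^34 (1 + log n)^18 F² / (n - 1))³ ≤ F²` and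
`F √6 / √(n (n - 1)) ≤ 1/2` (four instances of `eventually_log_pow_mul_rpow_le`, assembled by
`sharpRanges_of_master`). [folklore] -/
theorem eventually_sharp_ranges (C₁ : ℝ) (hC₁ : C₁ < 3 / 4) :
    ∃ n₀ : ℕ, ∀ n : ℕ, n₀ ≤ n → ∀ F : ℝ, 0 < F → F ≤ 8 * (n : ℝ) ^ C₁ →
      40 ≤ n ∧ 1400000 * (1 + Real.log n) ^ 2 ≤ (n : ℝ) ∧
      10 ^ 34 * (1 + Real.log n) ^ 18 * F ^ 2 / ((n : ℝ) - 1) ≤ (n : ℝ) ^ 4 ∧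
      4096 * (10 ^ 34 * (1 + Real.log n) ^ 18 * F ^ 2 / ((n : ℝ) - 1)) ^ 3 ≤ F ^ 2 ∧
      F * (Real.sqrt 6 / Real.sqrt ((n : ℝ) * ((n : ℝ) - 1))) ≤ 1 / 2 := by
  obtain ⟨N₂, hN₂⟩ :=
    eventually_log_pow_mul_rpow_le 2 0 1 1400000 (by norm_num) (by norm_num)
  obtain ⟨N₃, hN₃⟩ :=
    eventually_log_pow_mul_rpow_le 18 (C₁ + C₁) ((5 : ℕ) : ℝ) (128 * 10 ^ 34)
      (by push_cast; linarith) (by norm_num)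
  obtain ⟨N₄, hN₄⟩ :=
    eventually_log_pow_mul_rpow_le 54 (C₁ + C₁ + C₁ + C₁) ((3 : ℕ) : ℝ) (8 * 4096 ^ 2 * 10 ^ 102)
      (by push_cast; linarith) (by norm_num)
  obtain ⟨N₅, hN₅⟩ :=
    eventually_log_pow_mul_rpow_le 0 C₁ 1 96 (by linarith) (by norm_num)
  refine ⟨max 40 (max N₂ (max N₃ (max N₄ N₅))), fun n hn F hF0 hFle => ?_⟩
  simp only [max_le_iff] at hn
  obtain ⟨h40, hn2, hn3, hn4, hn5⟩ := hn
  have hx : (40 : ℝ) ≤ n := by exact_mod_cast h40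
  exact ⟨h40, sharpRanges_of_master (by linarith) hF0 hFle (hN₂ n hn2) (hN₃ n hn3) (hN₄ n hn4)
    (hN₅ n hn5)⟩

end Summit.MatrixMultiplication.MatrixMultiplication.Theorems.PolynomialSlack
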